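import Literature.Analysis.FluidPDE.SelfSimilarCollapseAnsatz
import Literature.Analysis.FluidPDE.BoundedAnnihilator
import Literature.Analysis.FluidPDE.HarmonicLiouvilleLp
import HarnessLib

/-!
# Viscous rigidity of the EXACT power-law self-similar ansatz: off Leray's exponent the profile is harmonic

Summit `NavierStokesRegularity`, cell topic directory `FluidComputer`, namespace `…FluidComputer.SelfSimilarCensus` (the kernel side of the `ns-blowup`
cell's self-similar census `selfsim/SELFSIM-NOGO.md`); companion to the Literature file
`SelfSimilarCollapseAnsatz.lean` (the ansatz
`u(t, x) = (T − t)^{γ−1} U((T − t)^{−γ} x)`, `p(t, x) = (T − t)^{2(γ−1)} P((T − t)^{−γ} x)`, (SS_γ),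
and its momentum identity `ns_momentum_selfSimilarCollapse`). PROVED theorems only; no data, no
named facts.

## The observation (folklore; the cell census `SELFSIM-NOGO.md` row (M16) of the `ns-blowup` programme)

The Navier–Stokes equations have the ONE-parameter scaling symmetry `u ↦ λu(λx, λ²t)` (Leray 1934,
(3.11)–(3.12); Nečas–Růžička–Šverák 1996, Introduction), so an EXACT power-law self-similar solution
can only have the parabolic exponent `γ = ½`. The quantitative form of "can only": by
`ns_momentum_selfSimilarCollapse`, on the ansatz the momentum operator equals

  `(T−t)^{γ−2} • [ E(y) − ν (T−t)^{1−2γ} ΔU(y) ]`,  `E := (1−γ)U + DU(γy + U) + ∇P`,  `y = (T−t)^{−γ}x`,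

and for `γ ≠ ½` the factor `(T−t)^{1−2γ}` is a non-constant function of `t` at FIXED `y`. Hence, if
(SS_γ) solves `∂ₜu + (u·∇)u + ∇p = νΔu` with `ν ≠ 0` on any parabolic neighbourhood
`{T − δ < t < T, ‖x‖ < r}` of the singular point and `γ > 0` (so that `y` sweeps all of `ℝ³`), then
at every `y` BOTH `ΔU(y) = 0` AND `E(y) = 0`: the profile is harmonic on `ℝ³` and is at the same time
an exact self-similar EULER profile (`laplacian_eq_zero_of_ns_selfSimilarCollapse`). If the profile
is bounded — the standing hypothesis (M1) of the census — Liouville's theorem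
(`InnerProductSpace.HarmonicOnNhd.apply_eq_apply_of_abs_le`, tree) makes it CONSTANT
(`profile_eq_const_of_ns_selfSimilarCollapse`), so the ansatz is irrotational near the singular
point for every `t < T` (`curl_selfSimilarCollapse_eq_zero_of_ns`). Incompressibility, symmetry,
swirl and energy play no role; only `γ ≠ ½`, `γ > 0`, `ν ≠ 0`, `U ∈ C²` bounded.

So, for the EXACT ansatz, the census (M5)/(M7) of `SELFSIM-NOGO.md` collapses to: `γ ≠ ½` ⇒ constant
profile (this file); `γ = ½` ⇒ Tsai 1998 / Nečas–Růžička–Šverák 1996 (tree: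
`tsai_selfsimilar_holds`, `necas_ruzicka_sverak_holds`). What survives is only ASYMPTOTIC
self-similarity (Hou's scenarios; Chae's asymptotically-self-similar exclusions,
`ChaeAsymptoticallySelfSimilar*.lean`) and discrete self-similarity at `γ = ½` — exactly the objects
the census hands to the DSS programme.

## WHAT THIS IS NOT

Not a regularity theorem: "constant profile near `(0, T)`" is turned into "regular point" only in a
solution class (finite energy forces the constant to vanish when `γ < 1`; vorticity `≡ 0` near the
point feeds ε-regularity) — that step is the census's, not this file's. Not a statement about
asymptotically or discretely self-similar blow-up. Not Navier–Stokes-specific beyond the momentum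
operator: the divergence-free condition is never used.

## Mathlib / tree search

`lean search 'selfSimilarCollapse'` — only `SelfSimilarCollapseAnsatz.lean` (this file's import; no
rigidity statement there: its `IsSelfSimilarEulerProfile.ns_defect_selfSimilarCollapse` is the
converse direction). Liouville for bounded harmonic functions on a finite-dimensional inner product
space: tree `InnerProductSpace.HarmonicOnNhd.apply_eq_apply_of_abs_le` (`BoundedAnnihilator.lean`),
`harmonicOnNhd_of_laplacian_eq_zero` (`HarmonicLiouvilleLp.lean`); Mathlib
`InnerProductSpace.HarmonicOnNhd.comp_CLM`, `Real.rpow_rpow_inv`, `Ioo_mem_nhdsLT`.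

## References

* J. Leray, Acta Math. 63 (1934) 193–248, (3.11)–(3.12). [Leray1934]
* J. Nečas, M. Růžička, V. Šverák, Acta Math. 176 (1996) 283–294, Introduction (the scaling
  `λu(λx, λ²t)` and Leray's self-similar form). [NecasRuzickaSverak1996]
* P. Constantin, M. Ignatova, V. Vicol, arXiv:2602.17570 (2026), §3.1 (3.2)–(3.3) (the ansatz with
  free `γ` for Euler). [ConstantinIgnatovaVicol2026Putative]
-/

noncomputable section

open Set Filter Topology InnerProductSpace Metric
open scoped Laplacian RealInnerProductSpace

namespace Summit.NavierStokesRegularity.FluidComputer.SelfSimilarCensus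

open Literature.Analysis.FluidPDE

section ViscousRigidity

variable {γ T ν δ r t : ℝ}
  {U : EuclideanSpace ℝ (Fin 3) → EuclideanSpace ℝ (Fin 3)} {P : EuclideanSpace ℝ (Fin 3) → ℝ}

/-- For `γ > 0` the similarity point `y` is realised inside the parabolic neighbourhood
`{T−δ < t < T} × B(0, r)` at all times `t` close enough to `T`: eventually (as `t ↑ T`)
`t ∈ (T−δ, T)` and `(T−t)^γ • y ∈ B(0, r)`. [folklore] -/
theorem eventually_mem_Ioo_and_rpow_smul_mem_ball (hγ0 : 0 < γ) (hδ : 0 < δ) (hr : 0 < r)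
    (y : EuclideanSpace ℝ (Fin 3)) :
    ∀ᶠ t in 𝓝[<] T, t ∈ Ioo (T - δ) T ∧ (T - t) ^ γ • y ∈ ball (0 : EuclideanSpace ℝ (Fin 3)) r := by
  have h1 : Tendsto (fun t : ℝ => T - t) (𝓝[<] T) (𝓝 0) := by
    have : Tendsto (fun t : ℝ => T - t) (𝓝 T) (𝓝 (T - T)) :=
      (continuous_const.sub continuous_id).tendsto T
    rw [sub_self] at this
    exact this.mono_left nhdsWithin_le_nhds
  have h2 : ContinuousAt (fun s : ℝ => s ^ γ) 0 := Real.continuousAt_rpow_const 0 _ (Or.inr hγ0.le)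
  have h3 : Tendsto (fun t : ℝ => (T - t) ^ γ) (𝓝[<] T) (𝓝 0) := by
    have := h2.tendsto.comp h1
    rwa [Function.comp_def, Real.zero_rpow hγ0.ne'] at this
  have h4 : Tendsto (fun t : ℝ => (T - t) ^ γ • y) (𝓝[<] T) (𝓝 0) := by
    simpa using h3.smul_const y
  have hI : ∀ᶠ t in 𝓝[<] T, t ∈ Ioo (T - δ) T := Ioo_mem_nhdsLT (sub_lt_self T hδ)
  exact hI.and (h4.eventually_mem (ball_mem_nhds _ hr))

/-- Undoing the similarity change of variables below the blow-up time:
`(T−t)^{−γ} • ((T−t)^{γ} • y) = y` for `t < T`. [folklore] -/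
theorem rpow_neg_smul_rpow_smul (ht : t < T) (γ : ℝ) (y : EuclideanSpace ℝ (Fin 3)) :
    (T - t) ^ (-γ) • ((T - t) ^ γ • y) = y := by
  rw [smul_smul, ← Real.rpow_add (sub_pos.mpr ht), neg_add_cancel, Real.rpow_zero, one_smul]

/-- **One time slice.** If the ansatz satisfies the Navier–Stokes momentum equation at a point
`(t, x)` with `t < T`, then at `y = (T−t)^{−γ} x` the Euler-profile residual equals the effective
viscosity times the Laplacian of the profile:
`(1−γ)U(y) + DU(y)(γy + U(y)) + ∇P(y) = ν(T−t)^{1−2γ} • ΔU(y)`. [folklore] -/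
theorem eulerResidual_eq_effectiveViscosity_smul_laplacian (ht : t < T) (hU : ContDiff ℝ 2 U)
    {x : EuclideanSpace ℝ (Fin 3)}
    (hNS : timeDeriv (selfSimilarCollapse γ T U) t x +
        convect (selfSimilarCollapse γ T U t) (selfSimilarCollapse γ T U t) x +
        gradient (selfSimilarCollapsePressure γ T P t) x -
        ν • (Δ (selfSimilarCollapse γ T U t)) x = 0) :
    (1 - γ) • U ((T - t) ^ (-γ) • x) +
        fderiv ℝ U ((T - t) ^ (-γ) • x) (γ • ((T - t) ^ (-γ) • x) + U ((T - t) ^ (-γ) • x)) +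
        gradient P ((T - t) ^ (-γ) • x) =
      effectiveViscosity ν γ T t • (Δ U) ((T - t) ^ (-γ) • x) := by
  have hmain := ns_momentum_selfSimilarCollapse (γ := γ) (T := T) (P := P) ht
    (hU.of_le one_le_two) ν x
  rw [hNS] at hmain
  have hne : (T - t) ^ (γ - 2) ≠ 0 := (Real.rpow_pos_of_pos (sub_pos.mpr ht) _).ne'
  have h0 := (smul_eq_zero.mp hmain.symm).resolve_left hne
  exact sub_eq_zero.mp h0

/-- **Viscous rigidity of the exact ansatz (harmonic profile).** Let `γ > 0`, `γ ≠ ½`, `ν ≠ 0`,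
`U ∈ C²`, and suppose the ansatz (SS_γ) satisfies the Navier–Stokes momentum equation
`∂ₜu + (u·∇)u + ∇p − νΔu = 0` at every point of a parabolic neighbourhood
`{T − δ < t < T} × B(0, r)` of the singular point (`δ, r > 0`). Then at EVERY `y ∈ ℝ³` the profile is
harmonic, `ΔU(y) = 0`, and satisfies the exact self-similar Euler profile equation
`(1−γ)U(y) + DU(y)(γy + U(y)) + ∇P(y) = 0` (Constantin–Ignatova–Vicol (3.3) with `c = 0`).
Proof: two distinct time slices through the same `y` give
`E(y) = ν(T−tᵢ)^{1−2γ} ΔU(y)` (`i = 1, 2`) with `(T−t₁)^{1−2γ} ≠ (T−t₂)^{1−2γ}`. [folklore] -/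
theorem laplacian_eq_zero_of_ns_selfSimilarCollapse (hγ0 : 0 < γ) (hγ : γ ≠ 1 / 2) (hν : ν ≠ 0)
    (hδ : 0 < δ) (hr : 0 < r) (hU : ContDiff ℝ 2 U)
    (hNS : ∀ t ∈ Ioo (T - δ) T, ∀ x ∈ ball (0 : EuclideanSpace ℝ (Fin 3)) r,
      timeDeriv (selfSimilarCollapse γ T U) t x +
        convect (selfSimilarCollapse γ T U t) (selfSimilarCollapse γ T U t) x +
        gradient (selfSimilarCollapsePressure γ T P t) x -
        ν • (Δ (selfSimilarCollapse γ T U t)) x = 0)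
    (y : EuclideanSpace ℝ (Fin 3)) :
    (Δ U) y = 0 ∧ (1 - γ) • U y + fderiv ℝ U y (γ • y + U y) + gradient P y = 0 := by
  have hev := eventually_mem_Ioo_and_rpow_smul_mem_ball (T := T) hγ0 hδ hr y
  obtain ⟨t₁, ht₁I, ht₁B⟩ := hev.exists
  have ht₁T : t₁ < T := ht₁I.2
  have hJ : ∀ᶠ t in 𝓝[<] T, t ∈ Ioo t₁ T := Ioo_mem_nhdsLT ht₁T
  obtain ⟨t₂, ⟨ht₂I, ht₂B⟩, ht₂J⟩ := (hev.and hJ).exists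
  have ht₂T : t₂ < T := ht₂I.2
  have hne12 : t₁ ≠ t₂ := (ne_of_lt ht₂J.1)
  -- the two slices
  have e1 := eulerResidual_eq_effectiveViscosity_smul_laplacian (γ := γ) (T := T) (ν := ν) (P := P)
    ht₁T hU (hNS t₁ ht₁I _ ht₁B)
  have e2 := eulerResidual_eq_effectiveViscosity_smul_laplacian (γ := γ) (T := T) (ν := ν) (P := P)
    ht₂T hU (hNS t₂ ht₂I _ ht₂B)
  rw [rpow_neg_smul_rpow_smul ht₁T] at e1
  rw [rpow_neg_smul_rpow_smul ht₂T] at e2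
  -- the effective viscosities differ
  have hvisc : effectiveViscosity ν γ T t₁ ≠ effectiveViscosity ν γ T t₂ := by
    rw [effectiveViscosity_apply, effectiveViscosity_apply]
    intro h
    have h' : (T - t₁) ^ (1 - 2 * γ) = (T - t₂) ^ (1 - 2 * γ) := mul_left_cancel₀ hν h
    have hexp : (1 - 2 * γ) ≠ 0 := by
      intro h0
      exact hγ (by linarith)
    have h'' : ((T - t₁) ^ (1 - 2 * γ)) ^ (1 - 2 * γ)⁻¹ = ((T - t₂) ^ (1 - 2 * γ)) ^ (1 - 2 * γ)⁻¹ := by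
      rw [h']
    rw [Real.rpow_rpow_inv (sub_pos.mpr ht₁T).le hexp,
      Real.rpow_rpow_inv (sub_pos.mpr ht₂T).le hexp] at h''
    exact hne12 (by linarith)
  -- subtract
  have hdiff : (effectiveViscosity ν γ T t₁ - effectiveViscosity ν γ T t₂) • (Δ U) y = 0 := by
    rw [sub_smul, ← e1, ← e2, sub_self]
  have hΔ : (Δ U) y = 0 := (smul_eq_zero.mp hdiff).resolve_left (sub_ne_zero.mpr hvisc)
  refine ⟨hΔ, ?_⟩
  rw [e1, hΔ, smul_zero]

/-- Under the hypotheses of `laplacian_eq_zero_of_ns_selfSimilarCollapse` the profile is an exact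
self-similar Euler profile in the tree's sense (`IsSelfSimilarEulerProfile γ 0 U P`,
Constantin–Ignatova–Vicol (3.3)), provided `P ∈ C¹` and `div U = 0`; and it is harmonic.
[cite: ConstantinIgnatovaVicol2026Putative, §3.1.1 eq. (3.3)] -/
theorem isSelfSimilarEulerProfile_of_ns_selfSimilarCollapse (hγ0 : 0 < γ) (hγ : γ ≠ 1 / 2)
    (hν : ν ≠ 0) (hδ : 0 < δ) (hr : 0 < r) (hU : ContDiff ℝ 2 U) (hP : ContDiff ℝ 1 P)
    (hdiv : VectorCalculus.IsDivFree U)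
    (hNS : ∀ t ∈ Ioo (T - δ) T, ∀ x ∈ ball (0 : EuclideanSpace ℝ (Fin 3)) r,
      timeDeriv (selfSimilarCollapse γ T U) t x +
        convect (selfSimilarCollapse γ T U t) (selfSimilarCollapse γ T U t) x +
        gradient (selfSimilarCollapsePressure γ T P t) x -
        ν • (Δ (selfSimilarCollapse γ T U t)) x = 0) :
    IsSelfSimilarEulerProfile γ 0 U P ∧ HarmonicOnNhd U univ := by
  have h := laplacian_eq_zero_of_ns_selfSimilarCollapse (T := T) (P := P) hγ0 hγ hν hδ hr hU hNS
  refine ⟨⟨hU, hP, fun y => ?_, hdiv⟩, harmonicOnNhd_of_laplacian_eq_zero hU fun y => (h y).1⟩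
  rw [sub_zero]
  exact (h y).2

/-- **Viscous rigidity of the exact ansatz (constant profile).** With the hypotheses of
`laplacian_eq_zero_of_ns_selfSimilarCollapse` and a BOUNDED profile (`‖U‖ ≤ M`, hypothesis (M1) of
the census), the profile is constant: `U(y) = U(0)` for all `y` — Liouville's theorem for bounded
harmonic functions applied to each component `⟪a, U⟫`. [folklore] -/
theorem profile_eq_const_of_ns_selfSimilarCollapse (hγ0 : 0 < γ) (hγ : γ ≠ 1 / 2) (hν : ν ≠ 0)
    (hδ : 0 < δ) (hr : 0 < r) (hU : ContDiff ℝ 2 U) {M : ℝ} (hM : ∀ y, ‖U y‖ ≤ M)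
    (hNS : ∀ t ∈ Ioo (T - δ) T, ∀ x ∈ ball (0 : EuclideanSpace ℝ (Fin 3)) r,
      timeDeriv (selfSimilarCollapse γ T U) t x +
        convect (selfSimilarCollapse γ T U t) (selfSimilarCollapse γ T U t) x +
        gradient (selfSimilarCollapsePressure γ T P t) x -
        ν • (Δ (selfSimilarCollapse γ T U t)) x = 0)
    (y : EuclideanSpace ℝ (Fin 3)) : U y = U 0 := by
  have h := laplacian_eq_zero_of_ns_selfSimilarCollapse (T := T) (P := P) hγ0 hγ hν hδ hr hU hNS
  have hharm : HarmonicOnNhd U univ := harmonicOnNhd_of_laplacian_eq_zero hU fun y => (h y).1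
  apply ext_inner_left ℝ
  intro a
  have hcomp : HarmonicOnNhd (⇑(innerSL ℝ a) ∘ U) univ := hharm.comp_CLM (innerSL ℝ a)
  have hbdd : ∀ z, |(⇑(innerSL ℝ a) ∘ U) z| ≤ ‖a‖ * M := fun z => by
    rw [Function.comp_apply, innerSL_apply_apply ℝ]
    exact (abs_real_inner_le_norm a (U z)).trans (mul_le_mul_of_nonneg_left (hM z) (norm_nonneg a))
  have := hcomp.apply_eq_apply_of_abs_le hbdd y 0
  simpa [Function.comp_apply, innerSL_apply_apply ℝ] using this

/-- The curl of a constant field vanishes. [folklore] -/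
theorem curl_const_field (c : EuclideanSpace ℝ (Fin 3)) (x : EuclideanSpace ℝ (Fin 3)) :
    curl (fun _ : EuclideanSpace ℝ (Fin 3) => c) x = 0 := by
  ext i
  fin_cases i <;> simp [curl]

/-- **The exact ansatz off Leray's exponent is irrotational near the singular point.** With the
hypotheses of `profile_eq_const_of_ns_selfSimilarCollapse` (`γ > 0`, `γ ≠ ½`, `ν ≠ 0`, `U ∈ C²`
bounded, the Navier–Stokes momentum equation on a parabolic neighbourhood of `(0, T)`), the
vorticity of the ansatz vanishes identically: `curl (u(t)) (x) = 0` for all `t < T` and all `x ∈ ℝ³`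
(by `curl_selfSimilarCollapse`, `ω(t, x) = (T−t)^{−1} (curl U)(y)` and `U` is constant). This is the
form in which the census `SELFSIM-NOGO.md` (M16) uses the rigidity: for the EXACT power-law ansatz
only `γ = ½` (Leray; excluded by Tsai / Nečas–Růžička–Šverák) carries vorticity. [folklore] -/
theorem curl_selfSimilarCollapse_eq_zero_of_ns (hγ0 : 0 < γ) (hγ : γ ≠ 1 / 2) (hν : ν ≠ 0)
    (hδ : 0 < δ) (hr : 0 < r) (hU : ContDiff ℝ 2 U) {M : ℝ} (hM : ∀ y, ‖U y‖ ≤ M)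
    (hNS : ∀ t ∈ Ioo (T - δ) T, ∀ x ∈ ball (0 : EuclideanSpace ℝ (Fin 3)) r,
      timeDeriv (selfSimilarCollapse γ T U) t x +
        convect (selfSimilarCollapse γ T U t) (selfSimilarCollapse γ T U t) x +
        gradient (selfSimilarCollapsePressure γ T P t) x -
        ν • (Δ (selfSimilarCollapse γ T U t)) x = 0)
    {t : ℝ} (ht : t < T) (x : EuclideanSpace ℝ (Fin 3)) :
    curl (selfSimilarCollapse γ T U t) x = 0 := by
  have hconst : U = fun _ => U 0 :=
    funext fun y => profile_eq_const_of_ns_selfSimilarCollapse (T := T) (P := P) hγ0 hγ hν hδ hr hU hM hNS y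
  rw [curl_selfSimilarCollapse ht, hconst, curl_const_field, smul_zero]

/-- `T − t → 0⁺` as `t ↑ T`. [folklore] -/
theorem tendsto_sub_self_nhdsLT_nhdsGT (T : ℝ) :
    Tendsto (fun t : ℝ => T - t) (𝓝[<] T) (𝓝[>] 0) := by
  refine tendsto_nhdsWithin_of_tendsto_nhds_of_eventually_within _ ?_ ?_
  · have : Tendsto (fun t : ℝ => T - t) (𝓝 T) (𝓝 (T - T)) :=
      (continuous_const.sub continuous_id).tendsto T
    rw [sub_self] at this
    exact this.mono_left nhdsWithin_le_nhds
  · filter_upwards [self_mem_nhdsWithin] with t ht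
    exact sub_pos.mpr (Set.mem_Iio.mp ht)

/-- For `γ < 1` the velocity scale of the ansatz diverges: `(T − t)^{γ−1} → +∞` as `t ↑ T`. [folklore] -/
theorem tendsto_rpow_sub_one_nhdsLT_atTop (hγ1 : γ < 1) :
    Tendsto (fun t : ℝ => (T - t) ^ (γ - 1)) (𝓝[<] T) atTop := by
  have h := (tendsto_rpow_neg_nhdsGT_zero (y := γ - 1) (by linarith)).comp
    (tendsto_sub_self_nhdsLT_nhdsGT T)
  exact h

/-- **Viscous rigidity of the exact ansatz (trivial profile).** With the hypotheses of
`profile_eq_const_of_ns_selfSimilarCollapse` (`γ > 0`, `γ ≠ ½`, `ν ≠ 0`, `U ∈ C²` bounded, the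
Navier–Stokes momentum equation on a parabolic neighbourhood of `(0, T)`), if moreover `γ < 1`
(the velocity scale `(T−t)^{γ−1}` actually diverges — every blow-up ansatz) and the velocity stays
bounded at ONE point `x₀` as `t ↑ T` (`‖u(t, x₀)‖ ≤ C` for `t ∈ (T−δ, T)`; e.g. any point where the
solution is smooth up to `T`, hypothesis (M1) of the census "u bounded off `B_{r/2}`"), then the
profile vanishes identically, `U ≡ 0`: the exact ansatz carries NO singularity. Proof: `U` is the
constant `U(0)` and `‖u(t, x₀)‖ = (T−t)^{γ−1}‖U(0)‖ → ∞` unless `U(0) = 0`. [folklore] -/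
theorem profile_eq_zero_of_ns_selfSimilarCollapse (hγ0 : 0 < γ) (hγ : γ ≠ 1 / 2) (hγ1 : γ < 1)
    (hν : ν ≠ 0) (hδ : 0 < δ) (hr : 0 < r) (hU : ContDiff ℝ 2 U) {M : ℝ} (hM : ∀ y, ‖U y‖ ≤ M)
    (hNS : ∀ t ∈ Ioo (T - δ) T, ∀ x ∈ ball (0 : EuclideanSpace ℝ (Fin 3)) r,
      timeDeriv (selfSimilarCollapse γ T U) t x +
        convect (selfSimilarCollapse γ T U t) (selfSimilarCollapse γ T U t) x +
        gradient (selfSimilarCollapsePressure γ T P t) x -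
        ν • (Δ (selfSimilarCollapse γ T U t)) x = 0)
    {x₀ : EuclideanSpace ℝ (Fin 3)} {C : ℝ}
    (hbdd : ∀ t ∈ Ioo (T - δ) T, ‖selfSimilarCollapse γ T U t x₀‖ ≤ C)
    (y : EuclideanSpace ℝ (Fin 3)) : U y = 0 := by
  have hconst := profile_eq_const_of_ns_selfSimilarCollapse (T := T) (P := P) hγ0 hγ hν hδ hr hU hM hNS
  rw [hconst y]
  by_contra hne
  have hpos : 0 < ‖U 0‖ := norm_pos_iff.mpr hne
  -- `(T−t)^{γ−1} ‖U 0‖ → ∞`, so eventually it exceeds `C`, contradicting `hbdd`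
  have hlim : Tendsto (fun t : ℝ => (T - t) ^ (γ - 1) * ‖U 0‖) (𝓝[<] T) atTop :=
    (tendsto_rpow_sub_one_nhdsLT_atTop (T := T) hγ1).atTop_mul_const hpos
  have hI : ∀ᶠ t in 𝓝[<] T, t ∈ Ioo (T - δ) T := Ioo_mem_nhdsLT (sub_lt_self T hδ)
  obtain ⟨t, htC, htI⟩ := ((hlim.eventually_gt_atTop C).and hI).exists
  have ht : t < T := htI.2
  have hnorm : ‖selfSimilarCollapse γ T U t x₀‖ = (T - t) ^ (γ - 1) * ‖U 0‖ := by
    rw [norm_selfSimilarCollapse ht, hconst ((T - t) ^ (-γ) • x₀)]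
  have := hbdd t htI
  rw [hnorm] at this
  exact absurd this (not_le.mpr htC)

/-- **Census form** (SELFSIM-NOGO (M16) of the `ns-blowup` programme): under the hypotheses of
`profile_eq_zero_of_ns_selfSimilarCollapse` the ansatz itself vanishes on the whole slab
`t < T`: `u(t, x) = 0` for all `t < T`, `x ∈ ℝ³`. For the EXACT power-law ansatz with viscosity,
every exponent `γ ∈ (0, 1) ∖ {½}` is therefore empty, with no symmetry, swirl, energy or
incompressibility hypothesis; `γ = ½` is Leray's case (Tsai 1998 / Nečas–Růžička–Šverák 1996,
tree `tsai_selfsimilar_holds`). [folklore] -/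
theorem selfSimilarCollapse_eq_zero_of_ns (hγ0 : 0 < γ) (hγ : γ ≠ 1 / 2) (hγ1 : γ < 1)
    (hν : ν ≠ 0) (hδ : 0 < δ) (hr : 0 < r) (hU : ContDiff ℝ 2 U) {M : ℝ} (hM : ∀ y, ‖U y‖ ≤ M)
    (hNS : ∀ t ∈ Ioo (T - δ) T, ∀ x ∈ ball (0 : EuclideanSpace ℝ (Fin 3)) r,
      timeDeriv (selfSimilarCollapse γ T U) t x +
        convect (selfSimilarCollapse γ T U t) (selfSimilarCollapse γ T U t) x +
        gradient (selfSimilarCollapsePressure γ T P t) x -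
        ν • (Δ (selfSimilarCollapse γ T U t)) x = 0)
    {x₀ : EuclideanSpace ℝ (Fin 3)} {C : ℝ}
    (hbdd : ∀ t ∈ Ioo (T - δ) T, ‖selfSimilarCollapse γ T U t x₀‖ ≤ C)
    {t : ℝ} (_ht : t < T) (x : EuclideanSpace ℝ (Fin 3)) :
    selfSimilarCollapse γ T U t x = 0 := by
  have hU0 : U = 0 := funext fun y =>
    profile_eq_zero_of_ns_selfSimilarCollapse (T := T) (P := P) hγ0 hγ hγ1 hν hδ hr hU hM hNS hbdd y
  rw [hU0, selfSimilarCollapse_zero]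
  rfl

end ViscousRigidity

end Summit.NavierStokesRegularity.FluidComputer.SelfSimilarCensus

end
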